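import Mathlib.MeasureTheory.Integral.Bochner.Set
import Mathlib.MeasureTheory.Function.Jacobian
import Mathlib.MeasureTheory.Integral.Prod
import Mathlib.MeasureTheory.Integral.IntervalIntegral.FundThmCalculus
import Mathlib.GroupTheory.FreeAbelianGroup
import Mathlib.Analysis.Calculus.FDeriv.Basic
import Mathlib.Analysis.Calculus.ContDiff.Defs
import Literature.NumberTheory.Transcendental.SemialgebraicMaps
import Literature.NumberTheory.Transcendental.KZPeriods
import HarnessLib

-- provenance: harness21/H21/H21/Prelude/TranscendKaehlerL/KZCalculus.lean @ 89e2818 (interim HEAD d8f2665); M5 mechanical rewrite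
/-!
# The Kontsevich–Zagier calculus of moves (trunk T-TRANSCEND / G26, outline §1 d1, §2 C2)

Kontsevich–Zagier [KZ 2001, §1.2] list, informally, three rules by which one passes between two
integral representations of the same period: (1) additivity (in the domain and in the integrand),
(2) change of variables, (3) "Newton–Leibniz" (Stokes), all intermediate domains and functions
being algebraic with algebraic coefficients. The printed rule (3) is imprecise (no class of chains,
orientations or forms is fixed). **This file fixes a precise calculus**, in KZ's own top-degree
language and entirely inside Mathlib's Lebesgue integral on `Fin n → ℝ`:

* an *integral representation* (`Literature.KZ.IntegralRep n`) is a `ℚ`-semialgebraic domain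
  `σ ⊆ ℝⁿ`, a `ℚ`-semialgebraic function `f` on `σ` (KZ: "rational may be replaced by algebraic")
  which is absolutely integrable on `σ`; its value is `∫ x in σ, f x`;
* the *formal group* `Literature.NumberTheory.Transcendental.KZ.FormalRep` is the free abelian group on all representations, with
  the evaluation morphism `Literature.KZ.eval : FormalRep →+ ℝ`;
* the *moves* are four sets of generators `domainAddRel`, `integrandAddRel`,
  `changeOfVariablesRel`, `newtonLeibnizRel ⊆ FormalRep`, generating `Literature.NumberTheory.Transcendental.KZ.relations`; two
  representations are `Equivalent` if their difference lies in `relations`.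

Rule (3) is fixed as Newton–Leibniz along the last coordinate of a semialgebraic band
`{(x, t) | x ∈ τ, a x ≤ t ≤ b x}` with `a ≤ b` semialgebraic on `τ`, exactly as printed
("`∫_a^b f'(x) dx = f(b) − f(a)`", KZ §1.2 rule 3)) on each fibre: the primitive `F` is
semialgebraic on the band, `t ↦ F (x, t)` is continuous on `[a x, b x]` and has derivative the
integrand on `(a x, b x)` (no `C¹`-up-to-the-boundary demand, so KZ's own §1.1 step
`2∫√(1−x²) = ∫ 1/√(1−x²)`, primitive `x√(1−x²)`, is one move):
`∫_band ∂F/∂t = ∫_τ (F (x, b x) − F (x, a x))` (Fubini + FTC). By cylindrical decomposition every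
instance of Stokes on semialgebraic chains reduces to these moves combined with (1) and (2). We
state plainly that this *is* a fixing of an imprecision in print; equivalence with the
cohomological / Nori-motivic formulation of the period conjecture (Huber–Müller-Stach 2017,
Ch. 13) is **not** claimed here.

## Main definitions

* `Literature.NumberTheory.Transcendental.KZ.IntegralRep`, `IntegralRep.value`, `IntegralRep.IsRational` (KZ's literal shape:
  integrand a ratio of `ℚ`-polynomials — exactly the data of `Literature.NumberTheory.Transcendental.IsRealPeriod`).
* `Literature.NumberTheory.Transcendental.KZ.FormalRep`, `KZ.of`, `KZ.eval`.
* `Literature.NumberTheory.Transcendental.KZ.domainAddRel`, `integrandAddRel`, `changeOfVariablesRel`, `newtonLeibnizRel`,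
  `relations`, `Equivalent`.
* `Literature.NumberTheory.Transcendental.KZ.IntegralRep.restrict`, `IntegralRep.neg`, `IntegralRep.ofRational`.

## Main statements

* soundness of the moves: `eval_eq_zero_of_mem_*`, `relations_le_ker_eval`, `Equivalent.value_eq`;
* `isRealPeriod_iff_exists_isRational` (proved: definitional repackaging of `IsRealPeriod`);
* `isRealPeriod_iff_exists_integralRep` (KZ §1.1: algebraic integrands give the same periods);
* `exists_isRational_equivalent` (move version of the same remark);
* `exists_integralRep_sub` (every formal combination is a difference of two representations
  modulo moves).

## References

* M. Kontsevich, D. Zagier, *Periods*, in: Mathematics Unlimited — 2001 and Beyond, Springer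
  (2001), §§1.1–1.2.
* A. Huber, S. Müller-Stach, *Periods and Nori Motives*, Springer (2017), Ch. 12–13.

## Design notes

* Mathlib (searched `Period`, `semialgebraic`, `FreeAbelianGroup`) has no notion of period or of
  semialgebraic set; we use Mathlib's `FreeAbelianGroup`, `FreeAbelianGroup.lift`,
  `AddSubgroup.closure`, `MeasureTheory.IntegrableOn`, the Bochner integral, `HasFDerivWithinAt`,
  `ContinuousLinearMap.det`, `fderiv`, `Fin.init/snoc/last`.
* The structure is called `IntegralRep`, not `Rep`, to avoid shadowing Mathlib's root `Rep`
  under `open Literature.KZ`.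
* `IntegralRep 0` are the constants: `Fin 0 → ℝ` is one point of volume `1`, so
  `value r = r.integrand default`. This is the intended base of the calculus.
* Coefficients `ℚ` versus `ℚ̄ ∩ ℝ`: real algebraic parameters are `ℚ`-definable (KZ §1.1), so
  nothing is lost and no change of dimension is needed.
* The change-of-variables move carries exactly the hypotheses of
  `MeasureTheory.integral_image_eq_integral_abs_det_fderiv_smul`, so its soundness is provable
  from Mathlib.
* In `newtonLeibnizRel` the primitive `F` is required `ℚ`-semialgebraic on the band only, and its
  regularity is the fibrewise one of the printed rule (continuous on each closed fibre,
  differentiable with derivative the integrand on the open fibre); integrability of the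
  derivative on a.e. fibre comes from `r.integrableOn`. (An earlier version asked `F` to be `C¹`
  on an open `U ⊇ band`; that move is a special case of this one.)
  The hypothesis `a ≤ b` on the base is mandatory: without it the band fibre over `{b < a}` is
  empty while `F (x, b x) − F (x, a x)` need not vanish, and soundness fails.
-/

noncomputable section

open MeasureTheory MvPolynomial Set

namespace Literature.NumberTheory.Transcendental

namespace KZ

/-- An *integral representation* in the sense of Kontsevich–Zagier, in dimension `n`: a
`ℚ`-semialgebraic domain `σ ⊆ ℝⁿ`, an integrand `f : ℝⁿ → ℝ` which is a `ℚ`-semialgebraic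
function on `σ` (its graph over `σ` is `ℚ`-semialgebraic; KZ allow "algebraic" in place of
"rational") and absolutely integrable on `σ` for Lebesgue measure. The represented number is
`IntegralRep.value r = ∫ x in σ, f x`.

`IntegralRep 0` are the constants: `Fin 0 → ℝ` is a single point of volume `1`, so the value is
`f default`; this is the intended base case of the calculus.
[Kontsevich–Zagier 2001, §1.1; Huber–Müller-Stach 2017, Def. 12.1.1] [cite: KontsevichZagier2001, §1.1] -/
structure IntegralRep (n : ℕ) where
  /-- The domain of integration `σ ⊆ ℝⁿ`. -/
  domain : Set (Fin n → ℝ)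
  /-- The integrand (only its values on `domain` matter). -/
  integrand : (Fin n → ℝ) → ℝ
  /-- The domain is `ℚ`-semialgebraic. -/
  isSemialgebraic_domain : Literature.ModelTheory.ExponentialFields.IsSemialgebraic ℚ domain
  /-- The integrand is a `ℚ`-semialgebraic function on the domain. -/
  isSemialgebraicFunOn_integrand : IsSemialgebraicFunOn ℚ domain integrand
  /-- The integral converges absolutely. -/
  integrableOn : IntegrableOn integrand domain

variable {n m l : ℕ}

namespace IntegralRep

/-- The real number represented by an integral representation: `∫ x in σ, f x` (Lebesgue
measure on `Fin n → ℝ`). [Kontsevich–Zagier 2001, §1.1] [cite: KontsevichZagier2001, §1.1] -/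
def value (r : IntegralRep n) : ℝ := ∫ x in r.domain, r.integrand x

/-- The domain of an integral representation is Lebesgue measurable.
[Kontsevich–Zagier 2001, §1.1] [cite: KontsevichZagier2001, §1.1] -/
def measurableSet_domain : Prop :=
  ∀ (r : IntegralRep n),
    MeasurableSet r.domain

/- interim proof relied on results that are now named facts (D-0014); demoted to a fact by the M5 import, proof preserved:
:=
  r.isSemialgebraic_domain.measurableSet
-/

/-- An integral representation has *KZ's literal (rational) shape* if its integrand agrees on
the domain with a quotient `p / q` of polynomials with rational coefficients, `q` non-vanishing
on the domain. This is exactly the data of `Literature.NumberTheory.Transcendental.IsRealPeriod`.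
[Kontsevich–Zagier 2001, §1.1, Definition] [cite: KontsevichZagier2001, §1.1  Definition] -/
def IsRational (r : IntegralRep n) : Prop :=
  ∃ p q : MvPolynomial (Fin n) ℚ, (∀ x ∈ r.domain, aeval x q ≠ 0) ∧
    EqOn r.integrand (fun x => aeval x p / aeval x q) r.domain

end IntegralRep

/-- The free abelian group on all integral representations (of all dimensions): formal
`ℤ`-linear combinations of integrals, on which the moves of the KZ calculus act.
[Kontsevich–Zagier 2001, §1.2; Huber–Müller-Stach 2017, §13.1] [cite: KontsevichZagier2001, §1.2] -/
abbrev FormalRep : Type := FreeAbelianGroup (Σ n, IntegralRep n)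

/-- The generator of `FormalRep` attached to an integral representation.
[Kontsevich–Zagier 2001, §1.2] [cite: KontsevichZagier2001, §1.2] -/
def of (r : IntegralRep n) : FormalRep := FreeAbelianGroup.of ⟨n, r⟩

/-- Evaluation of formal combinations of integral representations: the additive extension of
`IntegralRep.value`. [Kontsevich–Zagier 2001, §1.2] [cite: KontsevichZagier2001, §1.2] -/
def eval : FormalRep →+ ℝ := FreeAbelianGroup.lift fun r => r.2.value

/-- `eval` of a generator is the value of the representation. [Kontsevich–Zagier 2001, §1.2] [cite: KontsevichZagier2001, §1.2] -/
@[simp] theorem eval_of (r : IntegralRep n) : eval (of r) = r.value :=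
  FreeAbelianGroup.lift_apply_of _ _

/-! ### The moves -/

/-- **Move (1a), additivity in the domain.** If `σ = σ₁ ∪ σ₂` with `σ₁ ∩ σ₂` Lebesgue-null and the
integrands of `r₁`, `r₂` agree with that of `r` on their domains, then `[r] − [r₁] − [r₂]` is a
relation. [Kontsevich–Zagier 2001, §1.2, rule (1); Huber–Müller-Stach 2017, §13.1] [cite: KontsevichZagier2001, §1.2  rule (1] -/
def domainAddRel : Set FormalRep :=
  {c | ∃ (n : ℕ) (r r₁ r₂ : IntegralRep n), r.domain = r₁.domain ∪ r₂.domain ∧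
    volume (r₁.domain ∩ r₂.domain) = 0 ∧ EqOn r.integrand r₁.integrand r₁.domain ∧
    EqOn r.integrand r₂.integrand r₂.domain ∧ c = of r - of r₁ - of r₂}

/-- **Move (1b), additivity in the integrand.** If `r`, `r₁`, `r₂` have the same domain and
`f = f₁ + f₂` on it, then `[r] − [r₁] − [r₂]` is a relation.
[Kontsevich–Zagier 2001, §1.2, rule (1); Huber–Müller-Stach 2017, §13.1] [cite: KontsevichZagier2001, §1.2  rule (1] -/
def integrandAddRel : Set FormalRep :=
  {c | ∃ (n : ℕ) (r r₁ r₂ : IntegralRep n), r₁.domain = r.domain ∧ r₂.domain = r.domain ∧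
    EqOn r.integrand (r₁.integrand + r₂.integrand) r.domain ∧ c = of r - of r₁ - of r₂}

/-- **Move (2), change of variables.** If `Φ` is a `ℚ`-semialgebraic map on `σ = r.domain`,
injective on `σ`, with a derivative `Φ' x` within `σ` at every `x ∈ σ`, `r'.domain = Φ '' σ` and
`f x = f' (Φ x) · |det Φ' x|` on `σ`, then `[r] − [r']` is a relation. These are exactly the
hypotheses of `MeasureTheory.integral_image_eq_integral_abs_det_fderiv_smul`.
[Kontsevich–Zagier 2001, §1.2, rule (2); Huber–Müller-Stach 2017, §13.1] [cite: KontsevichZagier2001, §1.2  rule (2] -/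
def changeOfVariablesRel : Set FormalRep :=
  {c | ∃ (n : ℕ) (r r' : IntegralRep n) (Φ : (Fin n → ℝ) → (Fin n → ℝ))
      (Φ' : (Fin n → ℝ) → (Fin n → ℝ) →L[ℝ] (Fin n → ℝ)),
    IsSemialgebraicMapOn ℚ r.domain Φ ∧ (∀ x ∈ r.domain, HasFDerivWithinAt Φ (Φ' x) r.domain x) ∧
    InjOn Φ r.domain ∧ r'.domain = Φ '' r.domain ∧
    (∀ x ∈ r.domain, r.integrand x = r'.integrand (Φ x) * |(Φ' x).det|) ∧
    c = of r - of r'}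

/-- **Move (3), Newton–Leibniz along the last coordinate** (KZ's printed rule 3),
"`∫_a^b f'(x) dx = f(b) − f(a)`", read fibrewise over a semialgebraic base; in several variables KZ
"replace the Newton–Leibniz formula by Stokes's formula", which reduces to this move combined
with (1) and (2) by cylindrical decomposition). Data: a base representation `r'` in dimension `n`
with domain `τ`, two `ℚ`-semialgebraic functions `a ≤ b` on `τ`, the band
`r.domain = {z | init z ∈ τ ∧ a (init z) ≤ z last ≤ b (init z)}`, and a primitive `F` which is
`ℚ`-semialgebraic on the band and, on each fibre, continuous on `[a x, b x]` and differentiable on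
`(a x, b x)` with derivative the integrand: `∂/∂t F (x, t) = r.integrand (x, t)`. If moreover
`r'.integrand x = F (x, b x) − F (x, a x)` on `τ`, then `[r] − [r']` is a relation. This is exactly
the regularity the printed formula needs (a primitive `f` of the integrand with values at the
endpoints); no `C¹`-up-to-the-boundary demand is made, so KZ's own §1.1 step
`2∫_{-1}^{1} √(1−x²) dx = ∫_{-1}^{1} dx/√(1−x²)` (primitive `x√(1−x²)`, not differentiable at `±1`)
is a single move. Absolute integrability of the derivative on the band is the field
`r.integrableOn`. The hypothesis `a ≤ b` on `τ` is mandatory for soundness.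
[Kontsevich–Zagier 2001, §1.2, rule (3); Huber–Müller-Stach 2017, §13.1] [cite: KontsevichZagier2001, §1.2  rule (3] -/
def newtonLeibnizRel : Set FormalRep :=
  {c | ∃ (n : ℕ) (r : IntegralRep (n + 1)) (r' : IntegralRep n) (a b : (Fin n → ℝ) → ℝ)
      (F : (Fin (n + 1) → ℝ) → ℝ),
    IsSemialgebraicFunOn ℚ r.domain F ∧
    IsSemialgebraicFunOn ℚ r'.domain a ∧ IsSemialgebraicFunOn ℚ r'.domain b ∧
    (∀ x ∈ r'.domain, a x ≤ b x) ∧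
    r.domain = {z | (Fin.init z : Fin n → ℝ) ∈ r'.domain ∧ a (Fin.init z) ≤ z (Fin.last n) ∧
      z (Fin.last n) ≤ b (Fin.init z)} ∧
    (∀ x ∈ r'.domain, ContinuousOn (fun t : ℝ => F (Fin.snoc x t)) (Icc (a x) (b x))) ∧
    (∀ x ∈ r'.domain, ∀ t ∈ Ioo (a x) (b x),
      HasDerivAt (fun s : ℝ => F (Fin.snoc x s)) (r.integrand (Fin.snoc x t)) t) ∧
    (∀ x ∈ r'.domain, r'.integrand x = F (Fin.snoc x (b x)) - F (Fin.snoc x (a x))) ∧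
    c = of r - of r'}

/-- The subgroup of relations of the KZ calculus: the subgroup of `FormalRep` generated by the
four moves `domainAddRel`, `integrandAddRel`, `changeOfVariablesRel`, `newtonLeibnizRel`.
[Kontsevich–Zagier 2001, §1.2; Huber–Müller-Stach 2017, §13.1] [cite: KontsevichZagier2001, §1.2] -/
def relations : AddSubgroup FormalRep :=
  AddSubgroup.closure (domainAddRel ∪ integrandAddRel ∪ changeOfVariablesRel ∪ newtonLeibnizRel)

/-- Two integral representations (possibly of different dimensions) are *equivalent* if one
passes from one to the other by the moves of the KZ calculus: `[r] − [r'] ∈ relations`.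
[Kontsevich–Zagier 2001, §1.2] [cite: KontsevichZagier2001, §1.2] -/
def Equivalent (r : IntegralRep n) (r' : IntegralRep m) : Prop := of r - of r' ∈ relations

/-- The domain-additivity move is a relation. [Kontsevich–Zagier 2001, §1.2] [cite: KontsevichZagier2001, §1.2] -/
lemma domainAddRel_subset_relations : domainAddRel ⊆ relations := fun _ hc =>
  AddSubgroup.subset_closure (Or.inl (Or.inl (Or.inl hc)))

/-- The integrand-additivity move is a relation. [Kontsevich–Zagier 2001, §1.2] [cite: KontsevichZagier2001, §1.2] -/
lemma integrandAddRel_subset_relations : integrandAddRel ⊆ relations := fun _ hc =>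
  AddSubgroup.subset_closure (Or.inl (Or.inl (Or.inr hc)))

/-- The change-of-variables move is a relation. [Kontsevich–Zagier 2001, §1.2] [cite: KontsevichZagier2001, §1.2] -/
lemma changeOfVariablesRel_subset_relations : changeOfVariablesRel ⊆ relations := fun _ hc =>
  AddSubgroup.subset_closure (Or.inl (Or.inr hc))

/-- The Newton–Leibniz move is a relation. [Kontsevich–Zagier 2001, §1.2] [cite: KontsevichZagier2001, §1.2] -/
lemma newtonLeibnizRel_subset_relations : newtonLeibnizRel ⊆ relations := fun _ hc =>
  AddSubgroup.subset_closure (Or.inr hc)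

namespace Equivalent

/-- Equivalence of representations is reflexive. [Kontsevich–Zagier 2001, §1.2] [cite: KontsevichZagier2001, §1.2] -/
@[refl] protected theorem refl (r : IntegralRep n) : Equivalent r r := by
  simp [Equivalent, relations.zero_mem]

/-- Equivalence of representations is symmetric. [Kontsevich–Zagier 2001, §1.2] [cite: KontsevichZagier2001, §1.2] -/
@[symm] protected theorem symm {r : IntegralRep n} {r' : IntegralRep m} (h : Equivalent r r') :
    Equivalent r' r := by
  simpa [Equivalent] using relations.neg_mem h

/-- Equivalence of representations is transitive. [Kontsevich–Zagier 2001, §1.2] [cite: KontsevichZagier2001, §1.2] -/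
@[trans] protected theorem trans {r : IntegralRep n} {r' : IntegralRep m} {r'' : IntegralRep l}
    (h : Equivalent r r') (h' : Equivalent r' r'') : Equivalent r r'' := by
  simpa [Equivalent] using relations.add_mem h h'

end Equivalent

/-! ### Soundness of the moves -/

/-- Soundness of domain additivity: `∫_{σ₁ ∪ σ₂} f = ∫_{σ₁} f + ∫_{σ₂} f` when `σ₁ ∩ σ₂` is null.
[Kontsevich–Zagier 2001, §1.2, rule (1)] [cite: KontsevichZagier2001, §1.2  rule (1] -/
def eval_eq_zero_of_mem_domainAddRel : Prop :=
  ∀ {c : FormalRep} (hc : c ∈ domainAddRel),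
    eval c = 0

/- interim proof relied on results that are now named facts (D-0014); demoted to a fact by the M5 import, proof preserved:
:= by
  obtain ⟨n, r, r₁, r₂, hdom, hnull, h₁, h₂, rfl⟩ := hc
  simp only [map_sub, eval_of, IntegralRep.value]
  rw [sub_sub, sub_eq_zero]
  have hae : AEDisjoint volume r₁.domain r₂.domain := hnull
  rw [hdom, setIntegral_union₀ hae r₂.measurableSet_domain.nullMeasurableSet
    (hdom ▸ r.integrableOn).left_of_union (hdom ▸ r.integrableOn).right_of_union,
    setIntegral_congr_fun r₁.measurableSet_domain h₁,
    setIntegral_congr_fun r₂.measurableSet_domain h₂]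
-/

/-- Soundness of integrand additivity: `∫_σ (f₁ + f₂) = ∫_σ f₁ + ∫_σ f₂` for integrable `fᵢ`.
[Kontsevich–Zagier 2001, §1.2, rule (1)] [cite: KontsevichZagier2001, §1.2  rule (1] -/
def eval_eq_zero_of_mem_integrandAddRel : Prop :=
  ∀ {c : FormalRep} (hc : c ∈ integrandAddRel),
    eval c = 0

/- interim proof relied on results that are now named facts (D-0014); demoted to a fact by the M5 import, proof preserved:
:= by
  obtain ⟨n, r, r₁, r₂, h₁, h₂, hadd, rfl⟩ := hc
  simp only [map_sub, eval_of, IntegralRep.value]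
  rw [sub_sub, sub_eq_zero]
  rw [setIntegral_congr_fun r.measurableSet_domain hadd, h₁, h₂]
  exact integral_add (h₁ ▸ r₁.integrableOn) (h₂ ▸ r₂.integrableOn)
-/

/-- Soundness of change of variables, from Mathlib's Jacobian formula
`MeasureTheory.integral_image_eq_integral_abs_det_fderiv_smul`.
[Kontsevich–Zagier 2001, §1.2, rule (2)] [cite: KontsevichZagier2001, §1.2  rule (2] -/
def eval_eq_zero_of_mem_changeOfVariablesRel : Prop :=
  ∀ {c : FormalRep} (hc : c ∈ changeOfVariablesRel),
    eval c = 0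

/- interim proof relied on results that are now named facts (D-0014); demoted to a fact by the M5 import, proof preserved:
:= by
  obtain ⟨n, r, r', Φ, Φ', -, hΦ', hinj, hdom, hf, rfl⟩ := hc
  simp only [map_sub, eval_of, IntegralRep.value, sub_eq_zero]
  rw [hdom, integral_image_eq_integral_abs_det_fderiv_smul volume r.measurableSet_domain hΦ' hinj,
    setIntegral_congr_fun r.measurableSet_domain hf]
  simp [smul_eq_mul, mul_comm]
-/

/-- Soundness of the Newton–Leibniz move: by Fubini along the last coordinate and the fundamental
theorem of calculus on each fibre `[a x, b x]` (non-empty since `a ≤ b`;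
`intervalIntegral.integral_eq_sub_of_hasDerivAt_of_le`, the derivative being integrable on
a.e. fibre by `r.integrableOn`), `∫_band ∂F/∂t = ∫_τ (F (x, b x) − F (x, a x))`.
[Kontsevich–Zagier 2001, §1.2, rule (3)] [cite: KontsevichZagier2001, §1.2  rule (3] -/
def eval_eq_zero_of_mem_newtonLeibnizRel : Prop :=
  ∀ {c : FormalRep} (hc : c ∈ newtonLeibnizRel),
    eval c = 0

/-- **Soundness of the KZ calculus**: every relation evaluates to `0`.
[Kontsevich–Zagier 2001, §1.2; Huber–Müller-Stach 2017, §13.1] [cite: KontsevichZagier2001, §1.2] -/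
def relations_le_ker_eval : Prop :=
  relations ≤ eval.ker

/- interim proof relied on results that are now named facts (D-0014); demoted to a fact by the M5 import, proof preserved:
:= by
  refine (AddSubgroup.closure_le _).mpr ?_
  rintro c (((hc | hc) | hc) | hc)
  · exact eval_eq_zero_of_mem_domainAddRel hc
  · exact eval_eq_zero_of_mem_integrandAddRel hc
  · exact eval_eq_zero_of_mem_changeOfVariablesRel hc
  · exact eval_eq_zero_of_mem_newtonLeibnizRel hc
-/

/-- Equivalent representations represent the same number. [Kontsevich–Zagier 2001, §1.2] [cite: KontsevichZagier2001, §1.2] -/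
def Equivalent.value_eq : Prop :=
  ∀ {r : IntegralRep n} {r' : IntegralRep m} (h : Equivalent r r'),
    r.value = r'.value

/- interim proof relied on results that are now named facts (D-0014); demoted to a fact by the M5 import, proof preserved:
:= by
  have := relations_le_ker_eval h
  rwa [AddMonoidHom.mem_ker, map_sub, eval_of, eval_of, sub_eq_zero] at this
-/

/-! ### Constructions of representations -/

namespace IntegralRep

/-- Restriction of an integral representation to a `ℚ`-semialgebraic subdomain.
[Kontsevich–Zagier 2001, §1.2] [cite: KontsevichZagier2001, §1.2] -/
def restrict (r : IntegralRep n) (s : Set (Fin n → ℝ)) (hs : Literature.ModelTheory.ExponentialFields.IsSemialgebraic ℚ s)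
    (hsr : s ⊆ r.domain) : IntegralRep n where
  domain := s
  integrand := r.integrand
  isSemialgebraic_domain := hs
  isSemialgebraicFunOn_integrand := r.isSemialgebraicFunOn_integrand.mono hsr hs
  integrableOn := r.integrableOn.mono_set hsr

/-- The domain of a restricted representation. [Kontsevich–Zagier 2001, §1.2] [cite: KontsevichZagier2001, §1.2] -/
@[simp] lemma domain_restrict (r : IntegralRep n) (s : Set (Fin n → ℝ)) (hs : Literature.ModelTheory.ExponentialFields.IsSemialgebraic ℚ s)
    (hsr : s ⊆ r.domain) : (r.restrict s hs hsr).domain = s := rfl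

/-- The integrand of a restricted representation. [Kontsevich–Zagier 2001, §1.2] [cite: KontsevichZagier2001, §1.2] -/
@[simp] lemma integrand_restrict (r : IntegralRep n) (s : Set (Fin n → ℝ))
    (hs : Literature.ModelTheory.ExponentialFields.IsSemialgebraic ℚ s) (hsr : s ⊆ r.domain) :
    (r.restrict s hs hsr).integrand = r.integrand := rfl

/-- The negative of an integral representation (same domain, opposite integrand).
[Kontsevich–Zagier 2001, §1.1 (periods form a ring)] [cite: KontsevichZagier2001, §1.1 (periods form a ring] -/
def neg (r : IntegralRep n) : IntegralRep n where
  domain := r.domain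
  integrand := -r.integrand
  isSemialgebraic_domain := r.isSemialgebraic_domain
  isSemialgebraicFunOn_integrand := r.isSemialgebraicFunOn_integrand.neg
  integrableOn := r.integrableOn.neg

/-- The domain of the negative representation. [Kontsevich–Zagier 2001, §1.1] [cite: KontsevichZagier2001, §1.1] -/
@[simp] lemma domain_neg (r : IntegralRep n) : r.neg.domain = r.domain := rfl

/-- The integrand of the negative representation. [Kontsevich–Zagier 2001, §1.1] [cite: KontsevichZagier2001, §1.1] -/
@[simp] lemma integrand_neg (r : IntegralRep n) : r.neg.integrand = -r.integrand := rfl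

/-- The value of the negative representation is the negative of the value.
[Kontsevich–Zagier 2001, §1.1] [cite: KontsevichZagier2001, §1.1] -/
@[simp] theorem value_neg (r : IntegralRep n) : r.neg.value = -r.value := by
  simp [value, neg, integral_neg]

/-- The integral representation `∫_σ p / q` given by KZ-literal data: a `ℚ`-semialgebraic `σ`,
polynomials `p q` over `ℚ` with `q ≠ 0` on `σ`, and absolute convergence. Semialgebraicity of the
integrand is `Literature.NumberTheory.Transcendental.isSemialgebraicFunOn_aeval_div_aeval`.
[Kontsevich–Zagier 2001, §1.1, Definition] [cite: KontsevichZagier2001, §1.1  Definition] -/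
def ofRational (σ : Set (Fin n → ℝ)) (p q : MvPolynomial (Fin n) ℚ) (hσ : Literature.ModelTheory.ExponentialFields.IsSemialgebraic ℚ σ)
    (hq : ∀ x ∈ σ, aeval x q ≠ 0) (hint : IntegrableOn (fun x => aeval x p / aeval x q) σ) :
    IntegralRep n where
  domain := σ
  integrand x := aeval x p / aeval x q
  isSemialgebraic_domain := hσ
  isSemialgebraicFunOn_integrand := isSemialgebraicFunOn_aeval_div_aeval hσ p q hq
  integrableOn := hint

/-- The domain of `ofRational σ p q`. [Kontsevich–Zagier 2001, §1.1] [cite: KontsevichZagier2001, §1.1] -/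
@[simp] lemma domain_ofRational (σ : Set (Fin n → ℝ)) (p q : MvPolynomial (Fin n) ℚ)
    (hσ : Literature.ModelTheory.ExponentialFields.IsSemialgebraic ℚ σ) (hq : ∀ x ∈ σ, aeval x q ≠ 0)
    (hint : IntegrableOn (fun x => aeval x p / aeval x q) σ) :
    (ofRational σ p q hσ hq hint).domain = σ := rfl

/-- The integrand of `ofRational σ p q` is `p / q`. [Kontsevich–Zagier 2001, §1.1] [cite: KontsevichZagier2001, §1.1] -/
@[simp] lemma integrand_ofRational (σ : Set (Fin n → ℝ)) (p q : MvPolynomial (Fin n) ℚ)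
    (hσ : Literature.ModelTheory.ExponentialFields.IsSemialgebraic ℚ σ) (hq : ∀ x ∈ σ, aeval x q ≠ 0)
    (hint : IntegrableOn (fun x => aeval x p / aeval x q) σ) :
    (ofRational σ p q hσ hq hint).integrand = fun x => aeval x p / aeval x q := rfl

/-- `ofRational` has KZ's literal (rational) shape. [Kontsevich–Zagier 2001, §1.1] [cite: KontsevichZagier2001, §1.1] -/
theorem isRational_ofRational (σ : Set (Fin n → ℝ)) (p q : MvPolynomial (Fin n) ℚ)
    (hσ : Literature.ModelTheory.ExponentialFields.IsSemialgebraic ℚ σ) (hq : ∀ x ∈ σ, aeval x q ≠ 0)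
    (hint : IntegrableOn (fun x => aeval x p / aeval x q) σ) :
    (ofRational σ p q hσ hq hint).IsRational :=
  ⟨p, q, hq, fun _ _ => rfl⟩

/-- The value of `ofRational σ p q` is `∫ x in σ, p x / q x`. [Kontsevich–Zagier 2001, §1.1] [cite: KontsevichZagier2001, §1.1] -/
@[simp] theorem value_ofRational (σ : Set (Fin n → ℝ)) (p q : MvPolynomial (Fin n) ℚ)
    (hσ : Literature.ModelTheory.ExponentialFields.IsSemialgebraic ℚ σ) (hq : ∀ x ∈ σ, aeval x q ≠ 0)
    (hint : IntegrableOn (fun x => aeval x p / aeval x q) σ) :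
    (ofRational σ p q hσ hq hint).value = ∫ x in σ, aeval x p / aeval x q := rfl

end IntegralRep

/-! ### Bridge to `Literature.NumberTheory.Transcendental.IsRealPeriod` -/

/-- Real periods are exactly the values of integral representations of KZ's literal (rational)
shape (definitional repackaging of `Literature.NumberTheory.Transcendental.IsRealPeriod`). [Kontsevich–Zagier 2001, §1.1] [cite: KontsevichZagier2001, §1.1] -/
def isRealPeriod_iff_exists_isRational : Prop :=
  ∀ {x : ℝ},
    IsRealPeriod x ↔ ∃ (n : ℕ) (r : IntegralRep n), r.IsRational ∧ r.value = x

/- interim proof relied on results that are now named facts (D-0014); demoted to a fact by the M5 import, proof preserved: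
:= by
  constructor
  · rintro ⟨n, σ, p, q, hσ, hq, hint, rfl⟩
    exact ⟨n, IntegralRep.ofRational σ p q hσ hq hint,
      IntegralRep.isRational_ofRational σ p q hσ hq hint, rfl⟩
  · rintro ⟨n, r, ⟨p, q, hq, heq⟩, rfl⟩
    exact ⟨n, r.domain, p, q, r.isSemialgebraic_domain, hq,
      r.integrableOn.congr_fun heq r.measurableSet_domain,
      setIntegral_congr_fun r.measurableSet_domain heq⟩
-/

/-- **Rational ⇔ algebraic integrands.** Real periods are exactly the values of integral
representations with `ℚ`-semialgebraic (i.e. real-algebraic) integrands: an algebraic integrand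
is reduced to a rational one by introducing more variables.
[Kontsevich–Zagier 2001, §1.1, remark after the Definition; Huber–Müller-Stach 2017, §12.2] [cite: KontsevichZagier2001, §1.1  remark after the Definition] -/
def isRealPeriod_iff_exists_integralRep : Prop :=
  ∀ {x : ℝ},
    IsRealPeriod x ↔ ∃ (n : ℕ) (r : IntegralRep n), r.value = x

/-- Move version of "rational ⇔ algebraic": every integral representation is equivalent, by the
moves of the calculus, to one of KZ's literal (rational) shape, possibly in more variables.
[Kontsevich–Zagier 2001, §1.1, remark after the Definition, and §1.2] [cite: KontsevichZagier2001, §1.1  remark after the Definition  and §] -/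
def exists_isRational_equivalent : Prop :=
  ∀ (r : IntegralRep n),
    ∃ (m : ℕ) (r' : IntegralRep m), r'.IsRational ∧ Equivalent r r'

/-- Every formal `ℤ`-combination of integral representations is, modulo the moves, a difference
of two representations (merge sums by disjoint translated unions in a common dimension, using
domain additivity and change of variables). Used to pass between the "two representations" and
the "kernel" forms of the period conjecture. [Kontsevich–Zagier 2001, §1.2] [cite: KontsevichZagier2001, §1.2] -/
def exists_integralRep_sub : Prop :=
  ∀ (c : FormalRep),
    ∃ (n m : ℕ) (r : IntegralRep n) (r' : IntegralRep m), c - (of r - of r') ∈ relations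

end KZ

end Literature.NumberTheory.Transcendental

/-! ### Proofs of the soundness facts (D-0014 discharges)

Kontsevich–Zagier [KZ 2001, §1.2] state the three rules without proof; their soundness is
elementary integration theory, supplied here from Mathlib: additivity and linearity of the set
integral, the Jacobian change-of-variables formula, and Fubini along the last coordinate followed
by the fundamental theorem of calculus on each fibre. -/

namespace Literature.NumberTheory.Transcendental

namespace KZ

variable {n m l : ℕ}

/-- Discharge of `IntegralRep.measurableSet_domain`: the domain of an integral representation is
`ℚ`-semialgebraic, hence Borel. [Kontsevich–Zagier 2001, §1.1] [cite: KontsevichZagier2001, §1.1] -/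
theorem IntegralRep.measurableSet_domain_holds : IntegralRep.measurableSet_domain (n := n) :=
  fun r => Literature.ModelTheory.ExponentialFields.IsSemialgebraic.measurableSet_holds r.isSemialgebraic_domain

/-- Discharge of `eval_eq_zero_of_mem_domainAddRel`: `∫_{σ₁ ∪ σ₂} f = ∫_{σ₁} f + ∫_{σ₂} f` when
`σ₁ ∩ σ₂` is null (`MeasureTheory.setIntegral_union₀`).
[Kontsevich–Zagier 2001, §1.2, rule (1)] [cite: KontsevichZagier2001, §1.2 rule (1)] -/
theorem eval_eq_zero_of_mem_domainAddRel_holds : eval_eq_zero_of_mem_domainAddRel := by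
  intro c hc
  obtain ⟨n, r, r₁, r₂, hdom, hnull, h₁, h₂, rfl⟩ := hc
  simp only [map_sub, eval_of, IntegralRep.value]
  rw [sub_sub, sub_eq_zero]
  have hae : AEDisjoint volume r₁.domain r₂.domain := hnull
  rw [hdom, setIntegral_union₀ hae (IntegralRep.measurableSet_domain_holds r₂).nullMeasurableSet
    (hdom ▸ r.integrableOn).left_of_union (hdom ▸ r.integrableOn).right_of_union,
    setIntegral_congr_fun (IntegralRep.measurableSet_domain_holds r₁) h₁,
    setIntegral_congr_fun (IntegralRep.measurableSet_domain_holds r₂) h₂]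

/-- Discharge of `eval_eq_zero_of_mem_integrandAddRel`: `∫_σ (f₁ + f₂) = ∫_σ f₁ + ∫_σ f₂` for
integrable `fᵢ` (`MeasureTheory.integral_add`).
[Kontsevich–Zagier 2001, §1.2, rule (1)] [cite: KontsevichZagier2001, §1.2 rule (1)] -/
theorem eval_eq_zero_of_mem_integrandAddRel_holds : eval_eq_zero_of_mem_integrandAddRel := by
  intro c hc
  obtain ⟨n, r, r₁, r₂, h₁, h₂, hadd, rfl⟩ := hc
  simp only [map_sub, eval_of, IntegralRep.value]
  rw [sub_sub, sub_eq_zero]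
  rw [setIntegral_congr_fun (IntegralRep.measurableSet_domain_holds r) hadd, h₁, h₂]
  exact integral_add (h₁ ▸ r₁.integrableOn) (h₂ ▸ r₂.integrableOn)

/-- Discharge of `eval_eq_zero_of_mem_changeOfVariablesRel`, from Mathlib's Jacobian formula
`MeasureTheory.integral_image_eq_integral_abs_det_fderiv_smul`.
[Kontsevich–Zagier 2001, §1.2, rule (2)] [cite: KontsevichZagier2001, §1.2 rule (2)] -/
theorem eval_eq_zero_of_mem_changeOfVariablesRel_holds :
    eval_eq_zero_of_mem_changeOfVariablesRel := by
  intro c hc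
  obtain ⟨n, r, r', Φ, Φ', -, hΦ', hinj, hdom, hf, rfl⟩ := hc
  simp only [map_sub, eval_of, IntegralRep.value, sub_eq_zero]
  rw [hdom, integral_image_eq_integral_abs_det_fderiv_smul volume
    (IntegralRep.measurableSet_domain_holds r) hΦ' hinj,
    setIntegral_congr_fun (IntegralRep.measurableSet_domain_holds r) hf]
  simp [smul_eq_mul, mul_comm]

/-- Discharge of `eval_eq_zero_of_mem_newtonLeibnizRel`: identify `ℝⁿ⁺¹` with `ℝ × ℝⁿ` by the
volume-preserving `MeasurableEquiv.piFinSuccAbove _ (Fin.last n)` (inverse `(t, x) ↦ Fin.snoc x t`),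
extend the integrand by zero off the band, apply Fubini (`MeasureTheory.integral_prod_symm`), and
on each fibre over `x ∈ τ` — where the extended integrand is the indicator of `[a x, b x]` and is
integrable for a.e. `x` (`Integrable.prod_left_ae`) — apply the fundamental theorem of calculus
`intervalIntegral.integral_eq_sub_of_hasDerivAt_of_le`; fibres over `x ∉ τ` vanish.
[Kontsevich–Zagier 2001, §1.2, rule (3)] [cite: KontsevichZagier2001, §1.2 rule (3)] -/
theorem eval_eq_zero_of_mem_newtonLeibnizRel_holds : eval_eq_zero_of_mem_newtonLeibnizRel := by
  intro c hc
  obtain ⟨n, r, r', a, b, F, -, -, -, hab, hdom, hcont, hderiv, hr', rfl⟩ := hc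
  simp only [map_sub, eval_of, IntegralRep.value, sub_eq_zero]
  have hτm : MeasurableSet r'.domain := IntegralRep.measurableSet_domain_holds r'
  have hbm : MeasurableSet r.domain := IntegralRep.measurableSet_domain_holds r
  -- split off the last coordinate
  set e : (Fin (n + 1) → ℝ) ≃ᵐ ℝ × (Fin n → ℝ) :=
    MeasurableEquiv.piFinSuccAbove (fun _ => ℝ) (Fin.last n) with he_def
  have he : MeasurePreserving e volume volume :=
    volume_preserving_piFinSuccAbove (fun _ => ℝ) (Fin.last n)
  have he_symm : ∀ p : ℝ × (Fin n → ℝ), e.symm p = Fin.snoc p.2 p.1 := fun p => by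
    simp [he_def, MeasurableEquiv.piFinSuccAbove, Fin.snocEquiv]
  -- membership in the band, fibrewise
  have hmem : ∀ x t, Fin.snoc x t ∈ r.domain ↔ x ∈ r'.domain ∧ t ∈ Icc (a x) (b x) := by
    intro x t
    rw [hdom]
    simp only [mem_setOf_eq, Fin.init_snoc, Fin.snoc_last, mem_Icc]
  -- the integrand extended by zero off the band, and its fibres
  set G : (Fin (n + 1) → ℝ) → ℝ := r.domain.indicator r.integrand with hG_def
  have hG : Integrable G := (integrable_indicator_iff hbm).mpr r.integrableOn
  have hfib_in : ∀ x ∈ r'.domain, (fun t => G (Fin.snoc x t)) =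
      (Icc (a x) (b x)).indicator (fun t => r.integrand (Fin.snoc x t)) := by
    intro x hx
    ext t
    by_cases ht : t ∈ Icc (a x) (b x)
    · rw [Set.indicator_of_mem ht, hG_def, Set.indicator_of_mem ((hmem x t).2 ⟨hx, ht⟩)]
    · rw [Set.indicator_of_notMem ht, hG_def,
        Set.indicator_of_notMem (fun h => ht ((hmem x t).1 h).2)]
  have hfib_out : ∀ x ∉ r'.domain, (fun t => G (Fin.snoc x t)) = fun _ => 0 := by
    intro x hx
    ext t
    rw [hG_def, Set.indicator_of_notMem (fun h => hx ((hmem x t).1 h).1)]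
  have hG2 : Integrable (fun p : ℝ × (Fin n → ℝ) => G (Fin.snoc p.2 p.1))
      ((volume : Measure ℝ).prod (volume : Measure (Fin n → ℝ))) := by
    have h := ((he.symm e).integrable_comp_emb e.symm.measurableEmbedding (g := G)).mpr hG
    rw [← Measure.volume_eq_prod]
    convert h using 1
    ext p
    simp [he_symm]
  calc ∫ z in r.domain, r.integrand z
      = ∫ z, G z := (integral_indicator hbm).symm
    _ = ∫ p, G (e.symm p) := ((he.symm e).integral_comp' G).symm
    _ = ∫ p : ℝ × (Fin n → ℝ), G (Fin.snoc p.2 p.1) ∂(volume.prod volume) := by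
        simp_rw [he_symm, Measure.volume_eq_prod]
    _ = ∫ x, ∫ t, G (Fin.snoc x t) := integral_prod_symm _ hG2
    _ = ∫ x, r'.domain.indicator
          (fun x => F (Fin.snoc x (b x)) - F (Fin.snoc x (a x))) x := by
        apply integral_congr_ae
        filter_upwards [hG2.prod_left_ae] with x hx
        by_cases hxτ : x ∈ r'.domain
        · rw [Set.indicator_of_mem hxτ, hfib_in x hxτ, integral_indicator measurableSet_Icc,
            integral_Icc_eq_integral_Ioc, ← intervalIntegral.integral_of_le (hab x hxτ)]
          apply intervalIntegral.integral_eq_sub_of_hasDerivAt_of_le (hab x hxτ) (hcont x hxτ)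
            (hderiv x hxτ)
          rw [intervalIntegrable_iff_integrableOn_Icc_of_le (hab x hxτ)]
          have hx' : Integrable (fun t => G (Fin.snoc x t)) := hx
          rw [hfib_in x hxτ] at hx'
          exact (integrable_indicator_iff measurableSet_Icc).mp hx'
        · rw [Set.indicator_of_notMem hxτ]
          rw [hfib_out x hxτ, integral_zero]
    _ = ∫ x in r'.domain, (F (Fin.snoc x (b x)) - F (Fin.snoc x (a x))) :=
        integral_indicator hτm
    _ = ∫ x in r'.domain, r'.integrand x := (setIntegral_congr_fun hτm fun x hx => hr' x hx).symm

/-- Discharge of `relations_le_ker_eval`, **soundness of the KZ calculus**: the subgroup generated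
by the four moves lies in the kernel of evaluation, since each move evaluates to `0`
(`eval_eq_zero_of_mem_*_holds`) and the kernel is a subgroup (`AddSubgroup.closure_le`).
[Kontsevich–Zagier 2001, §1.2; Huber–Müller-Stach 2017, §13.1] [cite: KontsevichZagier2001, §1.2] -/
theorem relations_le_ker_eval_holds : relations_le_ker_eval := by
  unfold relations_le_ker_eval relations
  refine (AddSubgroup.closure_le _).mpr ?_
  rintro c (((hc | hc) | hc) | hc)
  · exact eval_eq_zero_of_mem_domainAddRel_holds hc
  · exact eval_eq_zero_of_mem_integrandAddRel_holds hc
  · exact eval_eq_zero_of_mem_changeOfVariablesRel_holds hc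
  · exact eval_eq_zero_of_mem_newtonLeibnizRel_holds hc

/-- Discharge of `Equivalent.value_eq`: equivalent representations represent the same number
(from `relations_le_ker_eval_holds`). [Kontsevich–Zagier 2001, §1.2] [cite: KontsevichZagier2001, §1.2] -/
theorem Equivalent.value_eq_holds : Equivalent.value_eq (n := n) (m := m) := by
  intro r r' h
  have := relations_le_ker_eval_holds h
  rwa [AddMonoidHom.mem_ker, map_sub, eval_of, eval_of, sub_eq_zero] at this

/-- Discharge of `isRealPeriod_iff_exists_isRational` (definitional repackaging of
`Literature.NumberTheory.Transcendental.IsRealPeriod`). [Kontsevich–Zagier 2001, §1.1] [cite: KontsevichZagier2001, §1.1] -/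
theorem isRealPeriod_iff_exists_isRational_holds : isRealPeriod_iff_exists_isRational := by
  intro x
  constructor
  · rintro ⟨n, σ, p, q, hσ, hq, hint, rfl⟩
    exact ⟨n, IntegralRep.ofRational σ p q hσ hq hint,
      IntegralRep.isRational_ofRational σ p q hσ hq hint, rfl⟩
  · rintro ⟨n, r, ⟨p, q, hq, heq⟩, rfl⟩
    exact ⟨n, r.domain, p, q, r.isSemialgebraic_domain, hq,
      r.integrableOn.congr_fun heq (IntegralRep.measurableSet_domain_holds r),
      setIntegral_congr_fun (IntegralRep.measurableSet_domain_holds r) heq⟩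

end KZ

end Literature.NumberTheory.Transcendental
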